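import Summits.QuantumFields.YangMills.Theorems.LuscherReductionTwistedTraceScalingInnerOfTube
import HarnessLib

/-!
# ADMISSIBILITY of tubes for the gauge slice: a tube sandwiched between `{all links ρ-close to 1} ∩ {orbitDist < δ}` and `{orbitDist < δ}` (with `δ ≤ ρ/2`)
# has Faddeev–Popov weight `N ≥ n₀ > 0` on the whole inner region, `n₀` = Haar measure of a ball in the gauge group (β-independent)
# (lane A of S-BASE, crux `TwistedTraceScaling` stmt-QuantumFields-20203, sub-target C4 INNER; design note `pub/ym-fleet/ym-luscher-20007-p1/COARSE-DESIGN.md` §23)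

* `nearOne L ρ = {W : ∀ e, ‖W_e − 1‖_F < ρ}` (open); `gaugeBall L r = {h : ∀ x, ‖h_x − 1‖_F < r}` (open, contains `1`, positive Haar measure
  `gaugeMeasure_gaugeBall_pos`).
* ★ `frobNorm_gaugeTransform_sub_one_le`: `‖(W^h)_e − 1‖_F ≤ ‖W_e − 1‖_F + ‖h_x − 1‖_F + ‖h_y − 1‖_F` (`e = (x, y)`, unitary invariance of the Frobenius norm);
  hence `gaugeTransform_mem_nearOne`: `W ∈ nearOne (ρ/2)`, `h ∈ gaugeBall (ρ/4)` ⇒ `W^h ∈ nearOne ρ`.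
* ★ `tubeWeight_ge_of_subset`: if `nearOne ρ ∩ {orbitDist < δ} ⊆ T ⊆ ?` and `orbitDist U < δ ≤ ρ/2`, then `tubeWeight T U ≥ gaugeMeasure (gaugeBall (ρ/4))`:
  the minimising gauge `g₀` (`exists_orbitDist_eq`) puts every link of `U^{g₀}` within `ρ/2` of `1`, and the whole right translate `gaugeBall(ρ/4)·g₀` keeps
  `U^g` in `nearOne ρ ∩ {orbitDist < δ} ⊆ T`.
* ★★★ `tubeAdmissible_of_sandwich`: measurable tubes `T β` with `nearOne ρ ∩ {orbitDist < δ β} ⊆ T β ⊆ {orbitDist < δ β}` and `δ β ≤ ρ/2` eventually are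
  `TubeAdmissible L δ T` — the hypothesis of ★★★ `innerNoIntruderOneOrbitAt_of_tube` (`…InnerOfTube`).
With `…OrthoTubeCoverage` (`nearOne (1/5)`-configurations lie in the orthographic constant-mode tube with `|v_e|² ≤ 10·(ρ²/4)`), the tubes of COARSE-DESIGN §23.2 are
admissible as soon as they contain `nearOne ρ ∩ {orbitDist < δ}` — a condition on the designer, not on the analysis.
HONEST FRAMING: elementary bookkeeping for a stub of a child of the CONDITIONAL reduction route R2b1; no kernel estimate; C4 OPEN; not a gap, not Clay.
-/

set_option autoImplicit false

noncomputable section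

open MeasureTheory Filter Topology Real
open scoped BigOperators Matrix.Norms.Frobenius
open Literature.MathematicalPhysics.QuantumFieldTheory
open Literature.MathematicalPhysics.QuantumLattice

namespace Summit.QuantumFields.YangMills.Theorems.FemtoTransferGap

open TwoLattice.Avg

variable (L : ℕ) [NeZero L]

/-! ## §1 The near-vacuum set and balls in the gauge group -/

/-- Configurations all of whose links are `ρ`-close to `1` in Frobenius norm. [folklore] -/
def nearOne (ρ : ℝ) : Set (GaugeConfig 3 L SU2) := {W | ∀ e : Edge 3 L, frobNorm (((W e : SU2) : Matrix (Fin 2) (Fin 2) ℂ) - 1) < ρ}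

/-- Gauge transformations all of whose values are `r`-close to `1` in Frobenius norm. [folklore] -/
def gaugeBall (r : ℝ) : Set (Site 3 L → SU2) := {h | ∀ x : Site 3 L, frobNorm (((h x : SU2) : Matrix (Fin 2) (Fin 2) ℂ) - 1) < r}

omit [NeZero L] in
/-- `W ↦ ‖W_e − 1‖_F` is continuous. [folklore] -/
theorem continuous_frobNorm_link_sub_one (e : Edge 3 L) :
    Continuous fun W : GaugeConfig 3 L SU2 => frobNorm (((W e : SU2) : Matrix (Fin 2) (Fin 2) ℂ) - 1) := by
  have h1 : Continuous fun W : GaugeConfig 3 L SU2 => ((W e : SU2) : Matrix (Fin 2) (Fin 2) ℂ) - 1 :=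
    (continuous_subtype_val.comp (continuous_apply e)).sub continuous_const
  simp_rw [frobNorm_eq_norm]
  exact h1.norm

/-- The near-vacuum set is open. [folklore] -/
theorem isOpen_nearOne (ρ : ℝ) : IsOpen (nearOne L ρ) := by
  have h : nearOne L ρ = ⋂ e : Edge 3 L, {W | frobNorm (((W e : SU2) : Matrix (Fin 2) (Fin 2) ℂ) - 1) < ρ} := by
    ext W; simp [nearOne]
  rw [h]
  exact isOpen_iInter_of_finite fun e => isOpen_lt (continuous_frobNorm_link_sub_one L e) continuous_const

/-- The near-vacuum set is measurable. [folklore] -/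
theorem measurableSet_nearOne (ρ : ℝ) : MeasurableSet (nearOne L ρ) := by
  haveI : SecondCountableTopology SU2 := secondCountableTopology_su2
  exact (isOpen_nearOne L ρ).measurableSet

/-- The gauge ball is open. [folklore] -/
theorem isOpen_gaugeBall (r : ℝ) : IsOpen (gaugeBall L r) := by
  have hc : ∀ x : Site 3 L, Continuous fun h : Site 3 L → SU2 => frobNorm (((h x : SU2) : Matrix (Fin 2) (Fin 2) ℂ) - 1) := fun x => by
    have h1 : Continuous fun h : Site 3 L → SU2 => ((h x : SU2) : Matrix (Fin 2) (Fin 2) ℂ) - 1 :=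
      (continuous_subtype_val.comp (continuous_apply x)).sub continuous_const
    simp_rw [frobNorm_eq_norm]
    exact h1.norm
  have h : gaugeBall L r = ⋂ x : Site 3 L, {h | frobNorm (((h x : SU2) : Matrix (Fin 2) (Fin 2) ℂ) - 1) < r} := by
    ext h; simp [gaugeBall]
  rw [h]
  exact isOpen_iInter_of_finite fun x => isOpen_lt (hc x) continuous_const

omit [NeZero L] in
/-- `1` lies in every gauge ball of positive radius. [folklore] -/
theorem one_mem_gaugeBall {r : ℝ} (hr : 0 < r) : (1 : Site 3 L → SU2) ∈ gaugeBall L r := fun x => by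
  simpa [frobNorm_eq_norm] using hr

/-- ★ Gauge balls of positive radius have positive Haar measure. [folklore] -/
theorem gaugeMeasure_gaugeBall_pos {r : ℝ} (hr : 0 < r) : 0 < gaugeMeasure L (gaugeBall L r) := by
  haveI : SecondCountableTopology SU2 := secondCountableTopology_su2
  exact (isOpen_gaugeBall L r).measure_pos (gaugeMeasure L) ⟨1, one_mem_gaugeBall L hr⟩

/-! ## §2 Links of a gauge transform near the identity -/

omit [NeZero L] in
/-- ★ `‖(W^h)_e − 1‖_F ≤ ‖W_e − 1‖_F + ‖h_{x} − 1‖_F + ‖h_{y} − 1‖_F` for the link `e` from `x` to `y`. [folklore] -/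
theorem frobNorm_gaugeTransform_sub_one_le (h : Site 3 L → SU2) (W : GaugeConfig 3 L SU2) (e : Edge 3 L) :
    frobNorm (((gaugeTransform h W e : SU2) : Matrix (Fin 2) (Fin 2) ℂ) - 1) ≤
      frobNorm (((W e : SU2) : Matrix (Fin 2) (Fin 2) ℂ) - 1) + frobNorm (((h e.1 : SU2) : Matrix (Fin 2) (Fin 2) ℂ) - 1) +
        frobNorm (((h (e.1.shift e.2) : SU2) : Matrix (Fin 2) (Fin 2) ℂ) - 1) := by
  set A : Matrix (Fin 2) (Fin 2) ℂ := ((h e.1 : SU2) : Matrix (Fin 2) (Fin 2) ℂ) with hA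
  set B : Matrix (Fin 2) (Fin 2) ℂ := (((h (e.1.shift e.2))⁻¹ : SU2) : Matrix (Fin 2) (Fin 2) ℂ) with hB
  set M : Matrix (Fin 2) (Fin 2) ℂ := ((W e : SU2) : Matrix (Fin 2) (Fin 2) ℂ) with hM
  have hAu : A ∈ Matrix.unitaryGroup (Fin 2) ℂ := su2_mem_unitaryGroup _
  have hBu : B ∈ Matrix.unitaryGroup (Fin 2) ℂ := su2_mem_unitaryGroup _
  have hcoe : ((gaugeTransform h W e : SU2) : Matrix (Fin 2) (Fin 2) ℂ) = A * M * B := by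
    simp only [gaugeTransform, Submonoid.coe_mul, hA, hB, hM]
  -- `A M B − 1 = A (M − 1) B + (A − 1) B + (B − 1)`
  have hsplit : A * M * B - 1 = A * (M - 1) * B + (A - 1) * B + (B - 1) := by noncomm_ring
  rw [hcoe, hsplit]
  have h1 : frobNorm (A * (M - 1) * B) = frobNorm (M - 1) := by
    rw [frobNorm_mul_unitary _ hBu, frobNorm_unitary_mul hAu]
  have h2 : frobNorm ((A - 1) * B) = frobNorm (A - 1) := frobNorm_mul_unitary _ hBu
  -- `‖B − 1‖ = ‖h_y⁻¹ − 1‖ = ‖h_y − 1‖`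
  have h3 : frobNorm (B - 1) = frobNorm (((h (e.1.shift e.2) : SU2) : Matrix (Fin 2) (Fin 2) ℂ) - 1) := by
    set C : Matrix (Fin 2) (Fin 2) ℂ := ((h (e.1.shift e.2) : SU2) : Matrix (Fin 2) (Fin 2) ℂ) with hC
    have hCu : C ∈ Matrix.unitaryGroup (Fin 2) ℂ := su2_mem_unitaryGroup _
    have hCB : C * B = 1 := by
      rw [hC, hB, ← Submonoid.coe_mul, mul_inv_cancel]; rfl
    have hBe : B - 1 = -(B * (C - 1)) := by
      have : B * C = 1 := by rw [hC, hB, ← Submonoid.coe_mul, inv_mul_cancel]; rfl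
      rw [Matrix.mul_sub, this, Matrix.mul_one]; abel
    rw [hBe, frobNorm_neg, frobNorm_unitary_mul hBu]
  calc frobNorm (A * (M - 1) * B + (A - 1) * B + (B - 1))
      ≤ frobNorm (A * (M - 1) * B + (A - 1) * B) + frobNorm (B - 1) := frobNorm_add_le' _ _
    _ ≤ frobNorm (A * (M - 1) * B) + frobNorm ((A - 1) * B) + frobNorm (B - 1) := by
        gcongr; exact frobNorm_add_le' _ _
    _ = _ := by rw [h1, h2, h3]

omit [NeZero L] in
/-- `W ∈ nearOne (ρ/2)` and `h ∈ gaugeBall (ρ/4)` put `W^h` in `nearOne ρ`. [folklore] -/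
theorem gaugeTransform_mem_nearOne {ρ : ℝ} {W : GaugeConfig 3 L SU2} {h : Site 3 L → SU2}
    (hW : ∀ e : Edge 3 L, frobNorm (((W e : SU2) : Matrix (Fin 2) (Fin 2) ℂ) - 1) < ρ / 2) (hh : h ∈ gaugeBall L (ρ / 4)) :
    gaugeTransform h W ∈ nearOne L ρ := fun e => by
  have := frobNorm_gaugeTransform_sub_one_le L h W e
  have h1 := hW e
  have h2 := hh e.1
  have h3 := hh (e.1.shift e.2)
  linarith

/-- Each link of `U^{g}` is within `gaugeDist g U` of `1`. [folklore] -/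
theorem frobNorm_link_le_gaugeDist (g : Site 3 L → SU2) (U : GaugeConfig 3 L SU2) (e : Edge 3 L) :
    frobNorm (((gaugeTransform g U e : SU2) : Matrix (Fin 2) (Fin 2) ℂ) - 1) ≤ gaugeDist g U := by
  unfold gaugeDist
  exact Finset.single_le_sum (f := fun e : Edge 3 L => frobNorm (((gaugeTransform g U e : SU2) : Matrix (Fin 2) (Fin 2) ℂ) - 1))
    (fun e _ => frobNorm_nonneg _) (Finset.mem_univ e)

/-! ## §3 ★ The Faddeev–Popov weight is bounded below on the inner region -/

/-- The weight of a measurable tube is the Haar measure of `{g : U^g ∈ T}`. [folklore] -/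
theorem tubeWeight_eq_measureReal {T : Set (GaugeConfig 3 L SU2)} (hT : MeasurableSet T) (U : GaugeConfig 3 L SU2) :
    tubeWeight T U = (gaugeMeasure L).real {g : Site 3 L → SU2 | gaugeTransform g U ∈ T} := by
  have hS : MeasurableSet {g : Site 3 L → SU2 | gaugeTransform g U ∈ T} := measurable_gaugeTransform_left U hT
  rw [← integral_indicator_one hS]
  unfold tubeWeight gaugeAvg
  refine integral_congr_ae (ae_of_all _ fun g => ?_)
  dsimp only
  by_cases hg : gaugeTransform g U ∈ T
  · rw [Set.indicator_of_mem hg, Set.indicator_of_mem (show g ∈ {g : Site 3 L → SU2 | gaugeTransform g U ∈ T} from hg)]; rfl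
  · rw [Set.indicator_of_notMem hg, Set.indicator_of_notMem (show g ∉ {g : Site 3 L → SU2 | gaugeTransform g U ∈ T} from hg)]

/-- ★ **Lower bound on the Faddeev–Popov weight**: if `nearOne ρ ∩ {orbitDist < δ} ⊆ T` (measurable) and `orbitDist U < δ ≤ ρ/2`, then
`tubeWeight T U ≥ gaugeMeasure (gaugeBall (ρ/4))` — a positive constant independent of `β`, `δ`, `U`. [folklore] -/
theorem tubeWeight_ge_of_subset {T : Set (GaugeConfig 3 L SU2)} (hT : MeasurableSet T) {ρ δ : ℝ} (hδρ : δ ≤ ρ / 2)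
    (hsub : nearOne L ρ ∩ {W | orbitDist W < δ} ⊆ T) {U : GaugeConfig 3 L SU2} (hU : orbitDist U < δ) :
    (gaugeMeasure L).real (gaugeBall L (ρ / 4)) ≤ tubeWeight T U := by
  rw [tubeWeight_eq_measureReal L hT]
  obtain ⟨g₀, hg₀⟩ := exists_orbitDist_eq U
  -- the right translate `gaugeBall · g₀` is inside `{g : U^g ∈ T}`
  have hincl : (fun h : Site 3 L → SU2 => h * g₀⁻¹) ⁻¹' gaugeBall L (ρ / 4) ⊆ {g : Site 3 L → SU2 | gaugeTransform g U ∈ T} := by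
    intro g hg
    have hmem : g * g₀⁻¹ ∈ gaugeBall L (ρ / 4) := hg
    have hW : ∀ e : Edge 3 L, frobNorm (((gaugeTransform g₀ U e : SU2) : Matrix (Fin 2) (Fin 2) ℂ) - 1) < ρ / 2 := fun e =>
      (frobNorm_link_le_gaugeDist L g₀ U e).trans_lt (by rw [hg₀]; linarith)
    have h1 : gaugeTransform g U = gaugeTransform (g * g₀⁻¹) (gaugeTransform g₀ U) := by
      rw [TT.gaugeTransform_gaugeTransform, inv_mul_cancel_right]
    refine hsub ⟨?_, ?_⟩
    · rw [h1]; exact gaugeTransform_mem_nearOne L hW hmem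
    · show orbitDist (gaugeTransform g U) < δ
      rw [orbitDist_gaugeTransform]; exact hU
  have hmeas : (gaugeMeasure L) ((fun h : Site 3 L → SU2 => h * g₀⁻¹) ⁻¹' gaugeBall L (ρ / 4)) = gaugeMeasure L (gaugeBall L (ρ / 4)) :=
    measure_preimage_mul_right _ _ _
  rw [Measure.real, Measure.real, ← hmeas]
  exact ENNReal.toReal_mono (measure_ne_top _ _) (measure_mono hincl)

/-! ## §4 ★★★ Admissibility of sandwiched tubes -/

/-- ★★★ **SANDWICHED TUBES ARE ADMISSIBLE**: if each `T β` is measurable and, eventually in `β`, `nearOne ρ ∩ {orbitDist < δ β} ⊆ T β ⊆ {orbitDist < δ β}` with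
`δ β ≤ ρ/2` for a fixed `ρ > 0`, then `TubeAdmissible L δ T` (the weight is `≥ gaugeMeasure (gaugeBall (ρ/4)) > 0` on the whole inner region).
[cite: Luscher1983, §3] -/
theorem tubeAdmissible_of_sandwich {δ : ℝ → ℝ} {T : ℝ → Set (GaugeConfig 3 L SU2)} (hTm : ∀ β, MeasurableSet (T β)) {ρ : ℝ} (hρ : 0 < ρ)
    (h : ∃ β1 : ℝ, ∀ β : ℝ, β1 ≤ β →
      δ β ≤ ρ / 2 ∧ nearOne L ρ ∩ {W | orbitDist W < δ β} ⊆ T β ∧ T β ⊆ {W | orbitDist W < δ β}) :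
    TubeAdmissible L δ T := by
  obtain ⟨β1, hβ1⟩ := h
  refine ⟨hTm, β1, fun β hβ => ?_⟩
  obtain ⟨hδρ, hsub, hsup⟩ := hβ1 β hβ
  have hn₀ : 0 < (gaugeMeasure L).real (gaugeBall L (ρ / 4)) :=
    ENNReal.toReal_pos (gaugeMeasure_gaugeBall_pos L (by linarith)).ne' (measure_ne_top _ _)
  refine ⟨fun U hU => hn₀.trans_le (tubeWeight_ge_of_subset L (hTm β) hδρ hsub hU), (gaugeMeasure L).real (gaugeBall L (ρ / 4)), hn₀, fun U hU => ?_⟩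
  exact tubeWeight_ge_of_subset L (hTm β) hδρ hsub (hsup hU)

end Summit.QuantumFields.YangMills.Theorems.FemtoTransferGap

end
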